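import Mathlib.Data.Matrix.Mul
import Literature.Analysis.FluidPDE.LinePullback
import Literature.Analysis.FunctionSpaces.TorusSpaceTimeCutoff
import HarnessLib

/-!
# The kernel of the transverse map of a unimodular completion is a single closed geodesic, and
# pulled-back profiles live in tubes around it (towards De Lellis–Kwon 2022, (3.6))

Analysis/FluidPDE support file on the discharge path of `Torus.DeLellisKwon2022_thm11`
(everything proved; no named facts). De Lellis–Kwon, Anal. PDE 15 (2022) = arXiv:2006.06482, §3.1,
(3.2) and (3.6): the Mikado profile `ψ_f` of direction `f ∈ ℤ³` is supported in the
`η/10`-neighbourhood of the closed geodesic `l_f = {x ∈ 𝕋³ : x - σf ∈ 2πℤ³ for some σ}`. For the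
pull-back construction `ψ = G ∘ L` of `LinePullback` this requires the kernel of the transverse map
`L : 𝕋³ → 𝕋²` to be EXACTLY that geodesic, which holds when the two forms are the first two rows of
a unimodular integer matrix (`LineDatum.ofUnimodular M N`, `MN = NM = 1`, direction `k = N e₂`):

* `LineDatum.hom_ofUnimodular_eq_zero_iff` — **`L y = 0 ↔ y = proj (t • k̃)` for some `t ∈ ℝ`**
  (on the unit torus `𝕋³ = ℝ³/ℤ³`: `l_k = {proj (t k̃)}`): if `θ₀·yv, θ₁·yv ∈ ℤ` then
  `yv = N(θ₀·yv, θ₁·yv, θ₂·yv)ᵀ ∈ ℤ³ + ℝ k̃`;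
* `LineDatum.exists_dist_geodesic_le_of_pull_ne_zero` — **tube support**: if `G : 𝕋² → F` vanishes
  off the image of the ball `‖w‖ ≤ r` of `ℝ²`, then every `y` with `(G ∘ L) y ≠ 0` is within
  distance `C_N r` of a point `proj (t • k̃)` of the geodesic, `C_N = ∑ᵢⱼ |Nᵢⱼ|` (shift the lift by
  `N (w, 0)ᵀ`, `w` a small lift of `L y`) — the form of (3.6) used in §6:
  `supp ψ_f ⊂ B(l_f, η/10)`.

## References

* C. De Lellis, H. Kwon, Anal. PDE 15 (2022) = arXiv:2006.06482, §3.1 (3.2), (3.6); §6.1 (6.1)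
  (the periodised lines `l_{f,p}`). [DelellisKwon2022]
-/

noncomputable section

open Set Function Matrix
open scoped ContDiff

namespace Literature.Analysis.FluidPDE

open FunctionSpaces FunctionSpaces.Torus

namespace LineDatum

/-- Euclidean `ℝ³`, local notation. -/
local notation "ℝ³" => EuclideanSpace ℝ (Fin 3)

variable {M N : Matrix (Fin 3) (Fin 3) ℤ} (hMN : M * N = 1) (hNM : N * M = 1)

/-- The real versions of the matrices. [folklore] -/
theorem map_mul_map_eq_one (hNM : N * M = 1) :
    N.map (Int.castRingHom ℝ) * M.map (Int.castRingHom ℝ) = 1 := by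
  rw [← Matrix.map_mul, hNM, Matrix.map_one _ (map_zero _) (map_one _)]

/-- `yv = N (M yv)` over `ℝ`. [folklore] -/
theorem mulVec_mulVec_eq_self (hNM : N * M = 1) (v : Fin 3 → ℝ) :
    (N.map (Int.castRingHom ℝ)) *ᵥ ((M.map (Int.castRingHom ℝ)) *ᵥ v) = v := by
  rw [Matrix.mulVec_mulVec, map_mul_map_eq_one hNM, Matrix.one_mulVec]

/-- The rows of an integer matrix paired with a real vector: `(P v)_i = ∑ₗ P i l vₗ`. [folklore] -/
theorem map_mulVec_apply (P : Matrix (Fin 3) (Fin 3) ℤ) (v : Fin 3 → ℝ) (i : Fin 3) :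
    ((P.map (Int.castRingHom ℝ)) *ᵥ v) i = ∑ l, (P i l : ℝ) * v l := by
  simp [Matrix.mulVec, dotProduct]

/-- The first two rows of `M yv` are the components of `L̃ yv`. [folklore] -/
theorem lin_ofUnimodular_apply (y : ℝ³) (l' : Fin 2) :
    (ofUnimodular M N hMN).lin y l' = ∑ l, (M (Fin.castSucc l') l : ℝ) * y l := by
  rw [lin_apply]; rfl

/-- **Points of the geodesic are in the kernel**: `L (proj (t • k̃)) = 0`. [folklore] -/
theorem hom_ofUnimodular_proj_smul_dirVec (t : ℝ) :
    (ofUnimodular M N hMN).hom (proj (t • (ofUnimodular M N hMN).dirVec)) = 0 := by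
  rw [hom_proj, map_smul, lin_dirVec, smul_zero, proj_zero]

/-- **The kernel of `L` is the closed geodesic of direction `k`**: for the datum of a unimodular
completion, `L y = 0 ↔ ∃ t, y = proj (t • k̃)` (DLK (3.2)/(6.1): `l_f` on the unit torus).
[cite: DelellisKwon2022, §3.1 (3.2)] -/
theorem hom_ofUnimodular_eq_zero_iff (hNM : N * M = 1) (y : UnitAddTorus (Fin 3)) :
    (ofUnimodular M N hMN).hom y = 0 ↔ ∃ t : ℝ, y = proj (t • (ofUnimodular M N hMN).dirVec) := by
  constructor
  · intro hy
    obtain ⟨yv, rfl⟩ := proj_surjective y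
    rw [hom_proj] at hy
    -- the two forms take integer values on `yv`
    have hint : ∀ l' : Fin 2, ∃ n : ℤ, (n : ℝ) = ∑ l, (M (Fin.castSucc l') l : ℝ) * yv l := by
      intro l'
      have h0 : (((ofUnimodular M N hMN).lin yv l' : ℝ) : UnitAddCircle) = 0 := by
        have := congrFun hy l'
        rwa [proj_apply] at this
      obtain ⟨n, hn⟩ := (AddCircle.coe_eq_zero_iff (1 : ℝ)).1 h0
      refine ⟨n, ?_⟩
      rw [← lin_ofUnimodular_apply hMN]
      simpa using hn
    choose n hn using hint
    -- `yv = N (n₀, n₁, s)ᵀ` with `s = θ₂ · yv`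
    set s : ℝ := ∑ l, (M 2 l : ℝ) * yv l with hs
    have hM : (M.map (Int.castRingHom ℝ)) *ᵥ (WithLp.ofLp yv) = ![(n 0 : ℝ), n 1, s] := by
      funext i
      rw [map_mulVec_apply M]
      fin_cases i
      · simpa using (hn 0).symm
      · simpa using (hn 1).symm
      · rfl
    have hdecomp : WithLp.ofLp yv = (N.map (Int.castRingHom ℝ)) *ᵥ ![(n 0 : ℝ), n 1, s] := by
      rw [← hM, mulVec_mulVec_eq_self hNM]
    -- split into the lattice part and the line part
    refine ⟨s, ?_⟩
    have hsplit : yv = latticeVec (fun l => N l 0 * n 0 + N l 1 * n 1) + s • (ofUnimodular M N hMN).dirVec := by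
      ext l
      have := congrFun hdecomp l
      simp only [Matrix.mulVec, dotProduct, Fin.sum_univ_three, Matrix.map_apply, Matrix.cons_val_zero,
        Matrix.cons_val_one, Matrix.cons_val] at this
      rw [show yv l = WithLp.ofLp yv l from rfl, this, PiLp.add_apply, latticeVec_apply, PiLp.smul_apply,
        dirVec_apply, ofUnimodular_k]
      simp only [eq_intCast, Int.cast_add, Int.cast_mul, smul_eq_mul]
      ring
    rw [hsplit, proj_add, proj_latticeVec, zero_add]
  · rintro ⟨t, rfl⟩
    exact hom_ofUnimodular_proj_smul_dirVec hMN t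

/-- The crude operator bound `C_N = ∑ᵢⱼ |Nᵢⱼ|` for `w ↦ N (w, 0)ᵀ`. [folklore] -/
def liftConst (N : Matrix (Fin 3) (Fin 3) ℤ) : ℝ := ∑ i, ∑ j, |(N i j : ℝ)|

/-- `C_N ≥ 0`. [folklore] -/
theorem liftConst_nonneg (N : Matrix (Fin 3) (Fin 3) ℤ) : 0 ≤ liftConst N :=
  Finset.sum_nonneg fun _ _ => Finset.sum_nonneg fun _ _ => abs_nonneg _

/-- The shift `N (w₀, w₁, 0)ᵀ ∈ ℝ³` correcting a lift by a transverse vector `w ∈ ℝ²`. [folklore] -/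
def shiftVec (N : Matrix (Fin 3) (Fin 3) ℤ) (w : EuclideanSpace ℝ (Fin 2)) : ℝ³ :=
  WithLp.toLp 2 ((N.map (Int.castRingHom ℝ)) *ᵥ ![w 0, w 1, 0])

/-- `ℓ² ≤ ℓ¹` on `ℝ³`: `‖v‖ ≤ |v₀| + |v₁| + |v₂|`. [folklore] -/
theorem norm_le_sum_abs_three (v : ℝ³) : ‖v‖ ≤ |v 0| + |v 1| + |v 2| := by
  rw [EuclideanSpace.norm_eq, Fin.sum_univ_three]
  simp only [Real.norm_eq_abs, sq_abs]
  have h0 := abs_nonneg (v 0); have h1 := abs_nonneg (v 1); have h2 := abs_nonneg (v 2)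
  calc Real.sqrt (v 0 ^ 2 + v 1 ^ 2 + v 2 ^ 2) ≤ Real.sqrt ((|v 0| + |v 1| + |v 2|) ^ 2) :=
        Real.sqrt_le_sqrt (by nlinarith [sq_abs (v 0), sq_abs (v 1), sq_abs (v 2)])
    _ = |v 0| + |v 1| + |v 2| := Real.sqrt_sq (by positivity)

/-- `‖N (w,0)ᵀ‖ ≤ C_N ‖w‖`. [folklore] -/
theorem norm_shiftVec_le (N : Matrix (Fin 3) (Fin 3) ℤ) (w : EuclideanSpace ℝ (Fin 2)) :
    ‖shiftVec N w‖ ≤ liftConst N * ‖w‖ := by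
  have hw : ∀ j : Fin 3, |(![w 0, w 1, 0] : Fin 3 → ℝ) j| ≤ ‖w‖ := by
    intro j
    fin_cases j
    · simpa using abs_apply_le_norm w 0
    · simpa using abs_apply_le_norm w 1
    · simp
  have hcoord : ∀ i, |shiftVec N w i| ≤ (∑ j, |(N i j : ℝ)|) * ‖w‖ := fun i => by
    show |((N.map (Int.castRingHom ℝ)) *ᵥ ![w 0, w 1, 0]) i| ≤ _
    rw [map_mulVec_apply N]
    calc |∑ j, (N i j : ℝ) * (![w 0, w 1, 0] : Fin 3 → ℝ) j| ≤ ∑ j, |(N i j : ℝ) * (![w 0, w 1, 0] : Fin 3 → ℝ) j| :=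
          Finset.abs_sum_le_sum_abs _ _
      _ ≤ ∑ j, |(N i j : ℝ)| * ‖w‖ := Finset.sum_le_sum fun j _ => by
          rw [abs_mul]; exact mul_le_mul_of_nonneg_left (hw j) (abs_nonneg _)
      _ = (∑ j, |(N i j : ℝ)|) * ‖w‖ := by rw [Finset.sum_mul]
  calc ‖shiftVec N w‖ ≤ |shiftVec N w 0| + |shiftVec N w 1| + |shiftVec N w 2| := norm_le_sum_abs_three _
    _ ≤ (∑ j, |(N 0 j : ℝ)|) * ‖w‖ + (∑ j, |(N 1 j : ℝ)|) * ‖w‖ + (∑ j, |(N 2 j : ℝ)|) * ‖w‖ :=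
        add_le_add (add_le_add (hcoord 0) (hcoord 1)) (hcoord 2)
    _ = liftConst N * ‖w‖ := by simp only [liftConst, Fin.sum_univ_three]; ring

/-- `L̃ (N (w,0)ᵀ) = w`: the shift lifts the transverse vector (`M N = 1`). [folklore] -/
theorem lin_shiftVec (w : EuclideanSpace ℝ (Fin 2)) : (ofUnimodular M N hMN).lin (shiftVec N w) = w := by
  have hMN' : M.map (Int.castRingHom ℝ) * N.map (Int.castRingHom ℝ) = 1 := by
    rw [← Matrix.map_mul, hMN, Matrix.map_one _ (map_zero _) (map_one _)]
  have hvec : (M.map (Int.castRingHom ℝ)) *ᵥ ((N.map (Int.castRingHom ℝ)) *ᵥ ![w 0, w 1, 0]) = ![w 0, w 1, 0] := by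
    rw [Matrix.mulVec_mulVec, hMN', Matrix.one_mulVec]
  ext l'
  rw [lin_ofUnimodular_apply]
  have h := congrFun hvec (Fin.castSucc l')
  rw [map_mulVec_apply M] at h
  have hsv : ∀ l, (shiftVec N w) l = ((N.map (Int.castRingHom ℝ)) *ᵥ ![w 0, w 1, 0]) l := fun l => rfl
  simp_rw [hsv]
  rw [h]
  fin_cases l' <;> rfl

/-- `shiftVec` is additive in the transverse vector. [folklore] -/
theorem shiftVec_sub (N : Matrix (Fin 3) (Fin 3) ℤ) (a b : EuclideanSpace ℝ (Fin 2)) :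
    shiftVec N (a - b) = shiftVec N a - shiftVec N b := by
  have hv : (![(a - b) 0, (a - b) 1, 0] : Fin 3 → ℝ) = ![a 0, a 1, 0] - ![b 0, b 1, 0] := by
    funext i; fin_cases i <;> simp
  ext l
  show ((N.map (Int.castRingHom ℝ)) *ᵥ ![(a - b) 0, (a - b) 1, 0]) l =
    ((N.map (Int.castRingHom ℝ)) *ᵥ ![a 0, a 1, 0]) l - ((N.map (Int.castRingHom ℝ)) *ᵥ ![b 0, b 1, 0]) l
  rw [hv, Matrix.mulVec_sub, Pi.sub_apply]

/-- **Tube support of pulled-back profiles** (the form of (3.6), `supp ψ_f ⊂ B(l_f, ·)`): if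
`G : 𝕋² → F` vanishes outside the image of the ball `{‖w - c‖ ≤ r} ⊂ ℝ²` (e.g. the profiles of
`TransversePeriodization`, centred at `c = (½, ½)`), then every point where `G ∘ L` does not vanish is
within distance `C_N r` of the TRANSLATED closed geodesic `{proj (t • k̃) + proj (N (c, 0)ᵀ)}` of the
datum of the unimodular completion. [cite: DelellisKwon2022, §3.1 (3.6)] -/
theorem exists_dist_geodesic_le_of_pull_ne_zero (hNM : N * M = 1) {F : Type*} [Zero F]
    {G : UnitAddTorus (Fin 2) → F} {c : EuclideanSpace ℝ (Fin 2)} {r : ℝ}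
    (hG : ∀ z, G z ≠ 0 → ∃ w : EuclideanSpace ℝ (Fin 2), proj w = z ∧ ‖w - c‖ ≤ r)
    {y : UnitAddTorus (Fin 3)} (hy : (ofUnimodular M N hMN).pull G y ≠ 0) :
    ∃ t : ℝ, dist y (proj (t • (ofUnimodular M N hMN).dirVec) + proj (shiftVec N c)) ≤ liftConst N * r := by
  obtain ⟨w, hwz, hwr⟩ := hG _ hy
  obtain ⟨yv, rfl⟩ := proj_surjective y
  -- the corrected lift lies on the geodesic
  have hker : (ofUnimodular M N hMN).hom (proj (yv - shiftVec N w)) = 0 := by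
    rw [hom_proj, map_sub, lin_shiftVec hMN,
      show ∀ a b : EuclideanSpace ℝ (Fin 2), proj (a - b) = proj a - proj b from fun _ _ => rfl,
      ← hom_proj, hwz, sub_self]
  obtain ⟨t, ht⟩ := (hom_ofUnimodular_eq_zero_iff hMN hNM _).1 hker
  refine ⟨t, ?_⟩
  rw [← ht, ← proj_add]
  calc dist (proj yv) (proj (yv - shiftVec N w + shiftVec N c)) ≤ ‖yv - (yv - shiftVec N w + shiftVec N c)‖ :=
        dist_proj_proj_le _ _
    _ = ‖shiftVec N (w - c)‖ := by rw [shiftVec_sub]; abel_nf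
    _ ≤ liftConst N * ‖w - c‖ := norm_shiftVec_le N (w - c)
    _ ≤ liftConst N * r := mul_le_mul_of_nonneg_left hwr (liftConst_nonneg N)

/-- The centred case `c = 0`: `y` is within `C_N r` of the closed geodesic `{proj (t • k̃)}` itself. [cite: DelellisKwon2022, §3.1 (3.6)] -/
theorem exists_dist_geodesic_le_of_pull_ne_zero_zero (hNM : N * M = 1) {F : Type*} [Zero F]
    {G : UnitAddTorus (Fin 2) → F} {r : ℝ}
    (hG : ∀ z, G z ≠ 0 → ∃ w : EuclideanSpace ℝ (Fin 2), proj w = z ∧ ‖w‖ ≤ r)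
    {y : UnitAddTorus (Fin 3)} (hy : (ofUnimodular M N hMN).pull G y ≠ 0) :
    ∃ t : ℝ, dist y (proj (t • (ofUnimodular M N hMN).dirVec)) ≤ liftConst N * r := by
  have hG' : ∀ z, G z ≠ 0 → ∃ w : EuclideanSpace ℝ (Fin 2), proj w = z ∧ ‖w - 0‖ ≤ r := fun z hz => by
    simpa using hG z hz
  obtain ⟨t, ht⟩ := exists_dist_geodesic_le_of_pull_ne_zero hMN hNM hG' hy
  refine ⟨t, ?_⟩
  have h0 : shiftVec N (0 : EuclideanSpace ℝ (Fin 2)) = 0 := by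
    have := shiftVec_sub N 0 0
    rwa [sub_self, sub_self] at this
  rwa [h0, proj_zero, add_zero] at ht

end LineDatum

end Literature.Analysis.FluidPDE
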